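import Mathlib.Data.Fintype.BigOperators
import Mathlib.Data.Fintype.Pi
import Mathlib.Data.Finset.Card
import Mathlib.Data.Finset.Powerset
import Mathlib.Data.Finset.Prod
import Mathlib.Algebra.Order.BigOperators.Group.Finset
import Mathlib.Algebra.BigOperators.Ring.Finset
import Mathlib.Logic.Function.Basic
import Mathlib.Tactic.Ring
import Mathlib.Tactic.Positivity
import HarnessLib

/-!
# Perfect hash families by counting

For a finite type `α` with `N` elements, a *size* bound `Θ` and a range `Fin R` with `2 Θ² < R`,
there is a family of `N + 1` maps `α → Fin R` such that every subset of `α` of size at most `Θ`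
is mapped injectively by at least one member of the family (`exists_perfectHashFamily`).

This is the standard probabilistic-method / counting argument (Fredman–Komlós–Szemerédi-style
perfect hashing; Mehlhorn 1984; Alon–Yuster–Zwick 1995, "colour coding"): a uniformly random map
`α → Fin R` is non-injective on a fixed `S` with `|S| ≤ Θ` with probability at most
`|S|(|S|-1)/R < 1/2` (union bound over ordered pairs), so all `N + 1` independent members fail on
`S` with probability `< 2^{-(N+1)}`, and a union bound over the at most `2^N` subsets `S` leaves a
good family. We phrase everything as cardinalities of finite sets of functions (no probability).

Consumer: the polylogarithmic-threshold `AC⁰` circuits of `PolylogThreshold.lean` (hash the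
input positions into `2Θ² + 1` buckets, count non-empty buckets).

## References

* K. Mehlhorn, *Data Structures and Algorithms 1: Sorting and Searching* (1984), §III.2.3
  (perfect hashing, existence of small perfect families by counting).
* N. Alon, R. Yuster, U. Zwick, *Color-coding*, J. ACM 42 (1995), §4 (perfect hash families).
-/

namespace Literature.Computability.Complexity

open Finset

variable {α : Type*} [Fintype α] [DecidableEq α]

namespace PerfectHash

/-- For `a ≠ b`, the maps `α → Fin R` with `g a = g b`, paired with a free value for `a`, are
all maps: `|{g | g a = g b}| · R = R ^ |α|` (the map `(g, c) ↦ update g a c` is a bijection).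
[folklore] -/
theorem card_collide_mul {R : ℕ} {a b : α} (hab : a ≠ b) :
    (univ.filter fun g : α → Fin R => g a = g b).card * R = R ^ Fintype.card α := by
  classical
  have e : {g : α → Fin R // g a = g b} × Fin R ≃ (α → Fin R) :=
    { toFun := fun p => Function.update p.1.1 a p.2
      invFun := fun g => (⟨Function.update g a (g b), by simp [hab.symm]⟩, g a)
      left_inv := by
        rintro ⟨⟨g, hg⟩, c⟩
        refine Prod.ext (Subtype.ext ?_) ?_
        · show Function.update (Function.update g a c) a ((Function.update g a c) b) = g
          rw [Function.update_of_ne hab.symm, Function.update_idem, ← hg, Function.update_eq_self]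
        · show (Function.update g a c) a = c
          simp
      right_inv := fun g => by
        simp only [Function.update_idem]
        exact Function.update_eq_self a g }
  have h := Fintype.card_congr e
  rw [Fintype.card_prod, Fintype.card_fin, Fintype.card_fun, Fintype.card_fin,
    Fintype.card_subtype] at h
  exact h

/-- Union bound: a map non-injective on `S` identifies some ordered pair of distinct points of
`S`, so `|{g | ¬ InjOn g S}| · R ≤ |S.offDiag| · R ^ |α|`. [folklore] -/
theorem card_not_injOn_mul_le (R : ℕ) (S : Finset α) :
    (univ.filter fun g : α → Fin R => ¬ Set.InjOn g ↑S).card * R ≤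
      S.offDiag.card * R ^ Fintype.card α := by
  classical
  have hsub : (univ.filter fun g : α → Fin R => ¬ Set.InjOn g ↑S) ⊆
      S.offDiag.biUnion fun p => univ.filter fun g : α → Fin R => g p.1 = g p.2 := by
    intro g hg
    simp only [mem_filter, mem_univ, true_and, Set.InjOn, not_forall] at hg
    obtain ⟨a, ha, b, hb, hgab, hne⟩ := hg
    simp only [mem_biUnion, mem_offDiag]
    exact ⟨(a, b), ⟨ha, hb, hne⟩, by simpa using hgab⟩
  calc (univ.filter fun g : α → Fin R => ¬ Set.InjOn g ↑S).card * R
        ≤ (S.offDiag.biUnion fun p =>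
            univ.filter fun g : α → Fin R => g p.1 = g p.2).card * R :=
        Nat.mul_le_mul_right _ (card_le_card hsub)
    _ ≤ (∑ p ∈ S.offDiag, (univ.filter fun g : α → Fin R => g p.1 = g p.2).card) * R :=
        Nat.mul_le_mul_right _ card_biUnion_le
    _ = ∑ p ∈ S.offDiag, (univ.filter fun g : α → Fin R => g p.1 = g p.2).card * R :=
        sum_mul _ _ _
    _ = ∑ p ∈ S.offDiag, R ^ Fintype.card α :=
        sum_congr rfl fun p hp => card_collide_mul (mem_offDiag.1 hp).2.2
    _ = S.offDiag.card * R ^ Fintype.card α := sum_const_nat fun _ _ => rfl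

/-- If `2 Θ² < R` and `|S| ≤ Θ` then at most half of all maps `α → Fin R` are non-injective
on `S`: `2 · |{g | ¬ InjOn g S}| ≤ R ^ |α|`. [folklore] -/
theorem two_mul_card_not_injOn_le {Θ R : ℕ} (hR : 2 * Θ ^ 2 < R) (S : Finset α)
    (hS : S.card ≤ Θ) :
    2 * (univ.filter fun g : α → Fin R => ¬ Set.InjOn g ↑S).card ≤ R ^ Fintype.card α := by
  have hRpos : 0 < R := lt_of_le_of_lt (Nat.zero_le _) hR
  have hoff : 2 * S.offDiag.card ≤ R := by
    rw [offDiag_card]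
    have : S.card * S.card ≤ Θ ^ 2 := by rw [sq]; exact Nat.mul_le_mul hS hS
    omega
  refine Nat.le_of_mul_le_mul_right ?_ hRpos
  set B := (univ.filter fun g : α → Fin R => ¬ Set.InjOn g ↑S).card
  calc 2 * B * R = 2 * (B * R) := by ring
    _ ≤ 2 * (S.offDiag.card * R ^ Fintype.card α) :=
        Nat.mul_le_mul_left _ (card_not_injOn_mul_le R S)
    _ = (2 * S.offDiag.card) * R ^ Fintype.card α := by ring
    _ ≤ R * R ^ Fintype.card α := Nat.mul_le_mul_right _ hoff
    _ = R ^ Fintype.card α * R := mul_comm _ _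

end PerfectHash

open PerfectHash in
/-- **Perfect hash families exist** (counting / probabilistic method): if `2 Θ² < R` there are
`|α| + 1` maps `α → Fin R` such that every `S ⊆ α` with `|S| ≤ Θ` is mapped injectively by
one of them. Proof: for each such `S` at most half of all maps are non-injective on `S`
(`PerfectHash.two_mul_card_not_injOn_le`), so at most a `2^{-(|α|+1)}` fraction of all
families is bad on `S`; summing over the at most `2^{|α|}` subsets, fewer than all families are
bad somewhere (Mehlhorn 1984, §III.2.3; Alon–Yuster–Zwick 1995, §4). [folklore] -/
theorem exists_perfectHashFamily (α : Type*) [Fintype α] [DecidableEq α] {Θ R : ℕ}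
    (hR : 2 * Θ ^ 2 < R) :
    ∃ hs : Fin (Fintype.card α + 1) → α → Fin R,
      ∀ S : Finset α, S.card ≤ Θ → ∃ l, Set.InjOn (hs l) ↑S := by
  classical
  set N := Fintype.card α with hN
  set subsets : Finset (Finset α) := univ.powerset.filter fun S => S.card ≤ Θ with hsubsets
  -- the families all of whose members are non-injective on `S`
  let badFam : Finset α → Finset (Fin (N + 1) → α → Fin R) := fun S =>
    Fintype.piFinset fun _ => univ.filter fun g : α → Fin R => ¬ Set.InjOn g ↑S
  have card_badFam : ∀ S, (badFam S).card =
      (univ.filter fun g : α → Fin R => ¬ Set.InjOn g ↑S).card ^ (N + 1) := fun S => by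
    simp only [badFam, Fintype.card_piFinset, prod_const, card_univ, Fintype.card_fin]
  set U : Finset (Fin (N + 1) → α → Fin R) := subsets.biUnion badFam with hU
  -- every bad family lies in `U`; we show `|U| < |all families|`
  have hRpos : 0 < R := lt_of_le_of_lt (Nat.zero_le _) hR
  have hsubsets_card : subsets.card ≤ 2 ^ N := by
    calc subsets.card ≤ (univ : Finset α).powerset.card := card_filter_le _ _
      _ = 2 ^ N := by rw [card_powerset, card_univ]
  have hbadFam : ∀ S ∈ subsets, 2 ^ (N + 1) * (badFam S).card ≤ (R ^ N) ^ (N + 1) := by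
    intro S hS
    have hS : S.card ≤ Θ := (mem_filter.1 hS).2
    rw [card_badFam, ← mul_pow]
    exact Nat.pow_le_pow_left (two_mul_card_not_injOn_le hR S hS) _
  have hUcard : 2 * U.card ≤ (R ^ N) ^ (N + 1) := by
    have h1 : U.card ≤ ∑ S ∈ subsets, (badFam S).card := card_biUnion_le
    have h2 : 2 ^ (N + 1) * ∑ S ∈ subsets, (badFam S).card ≤
        subsets.card * (R ^ N) ^ (N + 1) := by
      rw [mul_sum]
      calc ∑ S ∈ subsets, 2 ^ (N + 1) * (badFam S).card
          ≤ ∑ _S ∈ subsets, (R ^ N) ^ (N + 1) := sum_le_sum hbadFam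
        _ = subsets.card * (R ^ N) ^ (N + 1) := sum_const_nat fun _ _ => rfl
    have h3 : 2 ^ (N + 1) * U.card ≤ 2 ^ N * (R ^ N) ^ (N + 1) :=
      (Nat.mul_le_mul_left _ h1).trans (h2.trans (Nat.mul_le_mul_right _ hsubsets_card))
    have h4 : 2 ^ N * (2 * U.card) ≤ 2 ^ N * (R ^ N) ^ (N + 1) := by
      calc 2 ^ N * (2 * U.card) = 2 ^ (N + 1) * U.card := by ring
        _ ≤ 2 ^ N * (R ^ N) ^ (N + 1) := h3
    exact Nat.le_of_mul_le_mul_left h4 (Nat.two_pow_pos N)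
  have hUlt : U.card < (univ : Finset (Fin (N + 1) → α → Fin R)).card := by
    rw [card_univ, Fintype.card_fun, Fintype.card_fin, Fintype.card_fun, Fintype.card_fin, ← hN]
    have hpos : 0 < (R ^ N) ^ (N + 1) := by positivity
    omega
  -- pick a family outside `U`
  obtain ⟨hs, -, hhs⟩ := exists_mem_notMem_of_card_lt_card hUlt
  refine ⟨hs, fun S hS => ?_⟩
  have hSmem : S ∈ subsets := mem_filter.2 ⟨mem_powerset.2 (subset_univ S), hS⟩
  have hnot : hs ∉ badFam S := fun h => hhs (mem_biUnion.2 ⟨S, hSmem, h⟩)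
  simp only [badFam, Fintype.mem_piFinset, not_forall] at hnot
  obtain ⟨l, hl⟩ := hnot
  refine ⟨l, ?_⟩
  simpa using hl

end Literature.Computability.Complexity
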